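import Literature.NumberTheory.EllipticCurves.CasselsTatePairingSelmerTwo
import Literature.NumberTheory.EllipticCurves.TwoDescentTwoTorsionCharacter
import Literature.NumberTheory.QuadraticForms.HilbertSymbol
import HarnessLib

/-!
# Cassels 1998: the Cassels–Tate pairing on `Sel⁽²⁾(E/ℚ)` of a curve with full rational `2`-torsion
# is a sum of local Hilbert symbols of tangent forms (the "second `2`-descent" formula)

Topic `Literature/NumberTheory/EllipticCurves`, directory `Cassels1998` (one file = one source section,
D-0064). Family `bsd`, cell `bsd-print-cf2`, typer seat `-ty2` g48: the SUPPORT-GRADE item of the typer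
SUMMON of planner `bsd-print-cf2-plan` g23 (director-bsd (555)(B)/(573)(A)) — «the CT jump law on
`Sel₂` in Rédei symbols: state the pairing(-matrix) theorem as printed» — for the line
`cassels-tate-entries` on crux `stmt-BirchSwinnertonDyer-23431` (whose piece (S) needs the ENTRIES of
the Cassels–Tate form on `Sel₂(E_n)/κ(E_n[2])` as explicitly computable symbols). ONE named fact
(`def … : Prop`, D-0014), definitions WITH bodies, and theorems; no `sorry`, no `instance`, no
`notation`. Nothing curve-specific is proved; BSD is not advanced by this file.

## The printed statement (two held restatements; primary text not held)

PRIMARY: J. W. S. Cassels, *Second descents for elliptic curves*, J. reine angew. Math. **494** (1998)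
101–127 [Cassels1998] — paywalled, NOT held (`lit want` acq-14297, filed by `-ty2` g47); its Lemma 7.2
is the only numbered item quoted below, through the secondaries. The statement is transcribed from TWO
held restatements which agree word for word:

* Z. Wang, *Congruent elliptic curves with non-trivial Shafarevich–Tate groups*, Sci. China Math. 59
  (2016) [Wang2016CongruentSha], arXiv:1511.03810, §2 p0004 L5–L20 and §2.2 p0004 L88 – p0005 L24
  (held `paper:arxiv-1511.03810`): «we can identify the `2`-Selmer group of `E_n` with
  `Sel₂(E_n) = {Λ = (d₁, d₂, d₃) ∈ (ℚˣ/ℚˣ²)³ | D_Λ(𝔸) ≠ ∅, d₁d₂d₃ ∈ ℚˣ²}` where … `D_Λ` is a genus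
  one curve in `ℙ³` defined by `H₁ : −nt² + d₂u₂² − d₃u₃² = 0`, `H₂ : −nt² + d₃u₃² − d₁u₁² = 0`,
  `H₃ : 2nt² + d₁u₁² − d₂u₂² = 0`. Under this identification, `E_n(ℚ)/2E_n(ℚ)` is given by
  `(x − n, x + n, x)` …» (i.e. `d_i = x − e_i` for `(e₁, e₂, e₃) = (n, −n, 0)`); «Cassels [Cas98]
  introduced a skew-symmetric bilinear pairing on the `𝔽₂`-vector space `Sel₂(E_n)/E_n(ℚ)[2]` … It is
  defined as follows: for any `Λ = (d₁, d₂, d₃), Λ' = (d'₁, d'₂, d'₃) ∈ Sel₂(E_n)`, let `D_Λ` be the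
  genus one curve corresponding to `Λ` and `Q_i ∈ H_i(ℚ)` be a global point on `H_i`, the existence of
  `Q_i` follows from Hasse–Minkowski principle, since `H_i` is locally solvable everywhere as `D_Λ` is
  so. Let `L_i` be the tangent line of `H_i` at `Q_i` and view it as a hyperplane in `ℙ³`. Let
  `P = (P_p) ∈ D_Λ(𝔸)` be any adelic point on `D_Λ`, then `⟨Λ, Λ'⟩ = ∏_p ⟨Λ, Λ'⟩_p`,
  `⟨Λ, Λ'⟩_p = ∏_{i=1}^{3} (L_i(P_p), d'_i)_p` where `p` runs over all places of `ℚ` and `( , )_p` is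
  the Hilbert symbol at `ℚ_p`. … An important property of Cassels pairing says that the kernel of the
  Cassels pairing is `Im Sel₄(E_n)/E_n(ℚ)[2]` where `Im Sel₄(E_n)` is associated to the long exact
  sequence derived from `0 → E[2] → E[4] → E[2] → 0`. In fact almost all local Cassels pairing are
  `1`. Lemma 2 (Cassels [Cas98] Lemma 7.2). The local Cassels pairing `⟨ , ⟩_p = +1` if `p` satisfying
  (1) `p ≠ 2, ∞`; (2) The coefficients of `H_i` and `L_i` are all integral at `p` for `i = 1, 2, 3`;
  (3) Modulo `D_Λ` and `L_i` by `p`, they define a curve of genus `1` over `𝔽_p` together with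
  tangents to it.» And §1 p0003 L36: «Cassels [Cas98] introduced a pairing on `Sel₂(E_n)/E_n[2](ℚ)`
  with kernel given by `Im Sel₄(E_n)/E_n[2](ℚ)`».
* Z. Wang – S. Zhang, *On the quadratic twist of elliptic curves with full `2`-torsion* (2022), §2.3
  «Cassels pairing», p. 5 (held `paper:galaxy-pdf-2884733815236964660`, p0007): the same text for
  `E : y² = x(x − a²n)(x + b²n)` — i.e. for a general triple `(e₁, e₂, e₃) = (a²n, −b²n, 0)`:
  «(2.2) `H₁ : −b²nt² + d₂u₂² − d₃u₃² = 0`, `H₂ : −a²nt² + d₃u₃² − d₁u₁² = 0`,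
  `H₃ : 2c²nt² + d₁u₁² − d₂u₂² = 0` … the points `O, (a²n,0), (−b²n,0), (0,0)` and non-torsion
  `(x, y)` correspond to `(1,1,1), (2,2n,n), (−2n,2,−n), (−n,n,−1)` and `(x − a²n, x + b²n, x)` …
  Cassels in [Cas98] defined a skew-symmetric bilinear pairing `⟨−,−⟩` on the `𝔽₂`-vector space
  `Sel₂'(E⁽ⁿ⁾) := Sel₂(E⁽ⁿ⁾)/E⁽ⁿ⁾(ℚ)[2]`. We will write it additively. For any `Λ ∈ Sel₂(E⁽ⁿ⁾)`,
  choose `P = (P_v) ∈ D_Λ(𝔸_ℚ)`. Since `H_i` is locally solvable everywhere, there exists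
  `Q_i ∈ H_i(ℚ)` by Hasse–Minkowski principle. Let `L_i` be a linear form in three variables such that
  `L_i = 0` defines the tangent plane of `H_i` at `Q_i`. Then for any `Λ' = (d'₁, d'₂, d'₃) ∈ Sel₂`,
  define `⟨Λ, Λ'⟩ = Σ_v ⟨Λ, Λ'⟩_v ∈ 𝔽₂`, where `⟨Λ, Λ'⟩_v = Σ_{i=1}^{3} [L_i(P_v), d'_i]_v`. This
  pairing is independent of the choice of `P` and `Q_i`, and is trivial on `E⁽ⁿ⁾(ℚ)[2]`. Lemma 2.5
  ([Cas98, Lemma 7.2]) …».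
* That Cassels' recipe computes THE Cassels–Tate pairing (and not merely some alternating form with
  the same kernel): T. Fisher, *On binary quartics and the Cassels–Tate pairing*, Res. Number Theory
  (2022), arXiv:2208.14977, §1 (held, p0003 L16–L28): «Cassels [CaIV] showed that there is an
  alternating pairing `⟨ , ⟩_CT : S⁽ⁿ⁾(E/K) × S⁽ⁿ⁾(E/K) → ℚ/ℤ` whose kernel is the image of
  `S^{(n²)}(E/K)` … Cassels [Ca98] also described a method for computing the pairing in the case
  `n = 2`. His method involves solving conics over the field of definition of each `2`-torsion point».

READING in the general rational-`2`-torsion model `y² = (x − e₁)(x − e₂)(x − e₃)`, `e_i ∈ ℚ`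
distinct (Cassels' setting; both secondaries are instances, `(e₁,e₂,e₃) = (n,−n,0)` resp.
`(a²n, −b²n, 0)`): the `2`-covering of the class with components `(d₁, d₂, d₃)`, `d_i ↔ x − e_i`,
`d₁d₂d₃ ∈ ℚˣ²`, is `x − e_i = d_i u_i²/t²`, i.e. the intersection `D_Λ ⊂ ℙ³_{(t:u₁:u₂:u₃)}` of the
three quadric cones (any two give the third, `H₁ + H₂ + H₃ = 0`)
`H₁ : d₂u₂² − d₃u₃² − (e₃ − e₂)t² = 0`, `H₂ : d₃u₃² − d₁u₁² − (e₁ − e₃)t² = 0`,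
`H₃ : d₁u₁² − d₂u₂² − (e₂ − e₁)t² = 0` — for `(e₁,e₂,e₃) = (a²n, −b²n, 0)`, `a² + b² = 2c²`, these
are (2.2) of Wang–Zhang on the nose. The tangent plane of the cone `H_i` at a point `Q_i` is the polar
(bilinear) form `L_i(Q_i, ·)` of the quadratic form `H_i` (`H_i(Q + P) = H_i(Q) + 2L_i(Q,P) + H_i(P)`,
`L_i(Q, Q) = H_i(Q)`: `H₁_add`, `L₁_self` below).

## Tree dictionary (all constants exist; nothing is re-declared)

* `E/ℚ` with rational `2`-torsion: `W : WeierstrassCurve ℚ`, `W = ⟨0, −(e₁+e₂+e₃), 0,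
  e₁e₂+e₁e₃+e₂e₃, −e₁e₂e₃⟩` (= `y² = (x − e₁)(x − e₂)(x − e₃)`, Cassels' model; `[W.IsElliptic]`
  forces the `e_i` distinct) and `h : W.toAffine.SplitTwoTorsion e₁ e₂ e₃` (`TwoDescent.lean`; holds
  for this model, `splitTwoTorsion_of_eq`).
* `Sel⁽²⁾(E/ℚ) = selmerGroup W 2 ⊆ H¹(ℚ, E[2]) = galH1Torsion W 2` (`Selmer.lean`), `Ш = W.sha`,
  `π : Sel⁽ⁿ⁾ → Ш` and `[2]_* : Sel⁽⁴⁾ → Sel⁽²⁾` = `selmerToSha`, `selmerZSMul`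
  (`Rank1Residual/Typed/X5DescentSelmer.lean`), the pulled-back pairing `ctSelmer B 2 2`
  (`CasselsTatePairingSelmerTwo.lean`, `-ty2` g47, with `selmerTwo_kernel_iff_mem_range`).
* The components `(d₁, d₂)` of a class `c ∈ H¹(ℚ, E[2])`: `kummerEquiv ℚ 2 (W.twoTorsionCharH1 h c)`
  and the same for `h.swap₁₂` (`TwoDescentTwoTorsionCharacter.lean`; on Kummer classes these are
  `x − e₁`, `x − e₂` modulo squares, `kummerEquiv_twoTorsionCharH1_kummerMapTorsion` of
  `TwoDescentKummerBridge.lean`; the pair is injective on `H¹(ℚ, E[2])`,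
  `eq_zero_of_twoTorsionCharH1_eq_zero`) — `HasComponents` below, with `d₃` in the class of `d₁d₂`.
* Places and completions EXACTLY as in the definition of `selmerGroup`: finite places
  `v : HeightOneSpectrum (𝓞 ℚ)` with `ℚ_v = v.adicCompletion ℚ`, the infinite place
  `w : InfinitePlace ℚ` with `w.Completion`; «`P = (P_v) ∈ D_Λ(𝔸)`» = one point of `D_Λ(ℚ_v)` per
  place (`D_Λ` is projective, so an adelic point is just a family of local points).
* Hilbert symbols: `Literature.NumberTheory.QuadraticForms.hilbertSymbol F a b ∈ {1, −1}`
  (`HilbertSymbol.lean`, O'Meara §63B; evaluated over `v.adicCompletion ℚ` by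
  `hilbertSymbol_rat_eq_localSign`, reciprocity `hilbertReciprocity`). The multiplicative `∏_v ∏_i`
  of Wang 2016 and the additive `Σ_v Σ_i ∈ 𝔽₂` of Wang–Zhang are the same thing; here: the local term
  `localTerm ∈ {±1}` is the product of the three symbols, and the global symbol is `+1` iff the number
  of places with local term `−1` is EVEN (`Datum.oddFin`, `Datum.oddInf`; the finite set is finite —
  Lemma 7.2 — which is part of the statement).
* «`L_i(P_v)`» must be non-zero for the symbol to be defined (Cassels chooses the local points in
  general position; `D_Λ(ℚ_v)` is infinite once non-empty): an ADMISSIBLE local point is a point of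
  `D_Λ(ℚ_v)` off the three tangent planes (`IsAdmissible`); a `Datum` = the three rational points
  `Q_i ∈ H_i(ℚ)` + one admissible local point at every place. The value of Cassels' product does not
  depend on the scaling of the projective points (`∏_i (λ, d'_i)_v = (λ, d'₁d'₂d'₃)_v = 1`,
  `d'₁d'₂d'₃` a square), nor of the `L_i` (product formula), nor on the square class representatives —
  and, by the theorem, not on the datum.

WHAT IS VENDORED (faithfulness). The fact `pairing_selmerTwo_eq_hilbertSymbolProduct` says: for
`E : y² = (x − e₁)(x − e₂)(x − e₃)` over `ℚ` there is a bi-additive ALTERNATING pairing `B` on `Ш(E/ℚ)`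
with «`⟨a, Ш[m]⟩ = 0 ⟺ a ∈ mШ`» for every `m ≠ 0` — the Cassels–Tate pairing in the currency of the
tree's `casselsTate_pairing_levelKernel` (Milne *ADT* I 6.13(a)/6.17, Cassels 1962 IV; the conjunction
is printed in the sense that Cassels 1998 computes THE Cassels–Tate pairing, Fisher loc. cit.) — such
that for all `s, t ∈ Sel⁽²⁾(E/ℚ)` with component triples `Λ = (d_i)`, `Λ' = (d'_i)`: (a) a datum
exists (Hasse–Minkowski for the `H_i`, local points in general position — Cassels' «choose»); (b) for
EVERY datum the set of finite places with local term `−1` is finite and **`ctSelmer B 2 2 s t = 0`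
iff the number of places (finite and infinite) with local term `−1` is even** — i.e. the Cassels–Tate
pairing of `s, t` (an element of `{0, ½} ⊂ ℚ/ℤ`, `two_nsmul_selmerGroup_two`) is Cassels' product
`∏_v ∏_i (L_i(P_v), d'_i)_v` read in `{±1}`. Independence of the datum, symmetry, triviality on
`κ(E(ℚ))` and «kernel = `[2]_* Sel⁽⁴⁾`» are then THEOREMS (§4). Implied by, never stronger than, the
sources. No `_holds` is possible today (the tree has no construction of the Cassels–Tate pairing over
`ℚ` at level `2`: route item `CasselsTatePairingRat` is open); consumers take
`(hC : Cassels1998.pairing_selmerTwo_eq_hilbertSymbolProduct)`.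
-- TODO(general form): number fields `K` (Cassels works over any number field); curves with one
-- rational `2`-torsion point (Cassels 1998 §§8–10 / Fisher 2022 via binary quartics); the local
-- vanishing Lemma 7.2 as a separate evaluation theorem (it is a statement about `localTerm`, provable
-- from `hilbertSymbol_rat_eq_localSign` once «genus `1` mod `p`» is spelled out).

## References

* [Cassels1998] J. W. S. Cassels, *Second descents for elliptic curves*, J. reine angew. Math. 494
  (1998) 101–127, doi:10.1515/crll.1998.001 (the pairing `⟨Λ, Λ'⟩`; Lemma 7.2).
* [Wang2016CongruentSha] Z. Wang, Sci. China Math. 59 (2016) 2145–2166, arXiv:1511.03810, §1 (p. 3),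
  §2 and §2.2 (pp. 4–5).
* Z. Wang, S. Zhang, *On the quadratic twist of elliptic curves with full 2-torsion* (2022), §2.3 p. 5.
* T. Fisher, *On binary quartics and the Cassels–Tate pairing*, Res. Number Theory 8 (2022),
  arXiv:2208.14977, §1.
* [MilneADT2006] J. S. Milne, *Arithmetic Duality Theorems*, 2nd ed., I §6 Thm. 6.13(a), Lemma 6.17.
* [SilvermanAEC2009] J. H. Silverman, *The Arithmetic of Elliptic Curves*, 2nd ed., Thm. X.1.1,
  Prop. X.1.4 (the `2`-coverings `d_i u_i² = x − e_i`), Thm. X.4.14.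
-/

noncomputable section

open scoped Classical

universe u

namespace Literature.NumberTheory.EllipticCurves

open _root_.WeierstrassCurve Literature.NumberTheory.GaloisRepresentations
  Literature.NumberTheory.QuadraticForms IsDedekindDomain NumberField

namespace Cassels1998

/-! ## §1 The quadric cones `H₁, H₂, H₃`, the `2`-covering `D_Λ`, the tangent forms `L_i` -/

section Quadrics

variable {F : Type*} [CommRing F]

/-- `H₁(Λ)(P) = d₂u₂² − d₃u₃² − (e₃ − e₂)t²` for `e = (e₁,e₂,e₃)`, `d = (d₁,d₂,d₃)` (as `Fin 3 → F`,
`e 0 = e₁`, …) and `P = (t, u₁, u₂, u₃)` (as `Fin 4 → F`, `P 0 = t`, `P i.succ = u_i`): the cone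
through the `2`-covering `x − e_i = d_i u_i²/t²` not involving `u₁`.
[cite: Wang2016CongruentSha, §2 (arXiv:1511.03810 p0004 L11–L15), the display (H₁,H₂,H₃)] -/
def H₁ (e d : Fin 3 → F) (P : Fin 4 → F) : F :=
  d 1 * P 2 ^ 2 - d 2 * P 3 ^ 2 - (e 2 - e 1) * P 0 ^ 2

/-- `H₂(Λ)(P) = d₃u₃² − d₁u₁² − (e₁ − e₃)t²` (the cone not involving `u₂`).
[cite: Wang2016CongruentSha, §2 (arXiv:1511.03810 p0004 L11–L15)] -/
def H₂ (e d : Fin 3 → F) (P : Fin 4 → F) : F :=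
  d 2 * P 3 ^ 2 - d 0 * P 1 ^ 2 - (e 0 - e 2) * P 0 ^ 2

/-- `H₃(Λ)(P) = d₁u₁² − d₂u₂² − (e₂ − e₁)t²` (the cone not involving `u₃`).
[cite: Wang2016CongruentSha, §2 (arXiv:1511.03810 p0004 L11–L15)] -/
def H₃ (e d : Fin 3 → F) (P : Fin 4 → F) : F :=
  d 0 * P 1 ^ 2 - d 1 * P 2 ^ 2 - (e 1 - e 0) * P 0 ^ 2

/-- `H₁ + H₂ + H₃ = 0`: any two of the cones cut out `D_Λ` («a genus one curve in `ℙ³` defined by»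
the three displayed quadrics). [cite: Wang2016CongruentSha, §2 (arXiv:1511.03810 p0004 L9–L15)] -/
theorem H₁_add_H₂_add_H₃ (e d : Fin 3 → F) (P : Fin 4 → F) :
    H₁ e d P + H₂ e d P + H₃ e d P = 0 := by
  simp only [H₁, H₂, H₃]
  ring

/-- The `2`-covering `D_Λ(F) ⊂ ℙ³(F)`, as the set of NON-ZERO coordinate vectors `(t, u₁, u₂, u₃)`
with `H₁ = H₂ = 0` (hence `H₃ = 0`). [cite: Wang2016CongruentSha, §2 (arXiv:1511.03810 p0004 L5–L15)] -/
def homSpace (e d : Fin 3 → F) : Set (Fin 4 → F) :=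
  {P | P ≠ 0 ∧ H₁ e d P = 0 ∧ H₂ e d P = 0}

/-- Unfolding `homSpace`. [cite: Wang2016CongruentSha, §2 (arXiv:1511.03810 p0004 L5–L15)] -/
theorem mem_homSpace_iff (e d : Fin 3 → F) (P : Fin 4 → F) :
    P ∈ homSpace e d ↔ P ≠ 0 ∧ H₁ e d P = 0 ∧ H₂ e d P = 0 :=
  Iff.rfl

/-- On `D_Λ` the third cone vanishes too. [cite: Wang2016CongruentSha, §2 (arXiv:1511.03810 p0004 L9–L15)] -/
theorem H₃_eq_zero_of_mem_homSpace {e d : Fin 3 → F} {P : Fin 4 → F} (hP : P ∈ homSpace e d) :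
    H₃ e d P = 0 := by
  obtain ⟨-, h1, h2⟩ := hP
  have h := H₁_add_H₂_add_H₃ e d P
  rwa [h1, h2, zero_add, zero_add] at h

/-- The polar (tangent) form of `H₁` at `Q`: `L₁(Q, P) = d₂ Q₂ u₂ − d₃ Q₃ u₃ − (e₃ − e₂) Q₀ t`;
`L₁(Q, ·) = 0` is the tangent plane of the cone `H₁` at a point `Q` of it.
[cite: Wang2016CongruentSha, §2.2 (arXiv:1511.03810 p0005 L1: "L_i the tangent line of H_i at Q_i … as a hyperplane in ℙ³")] -/
def L₁ (e d : Fin 3 → F) (Q P : Fin 4 → F) : F :=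
  d 1 * Q 2 * P 2 - d 2 * Q 3 * P 3 - (e 2 - e 1) * Q 0 * P 0

/-- The polar (tangent) form of `H₂` at `Q`. [cite: Wang2016CongruentSha, §2.2 (arXiv:1511.03810 p0005 L1)] -/
def L₂ (e d : Fin 3 → F) (Q P : Fin 4 → F) : F :=
  d 2 * Q 3 * P 3 - d 0 * Q 1 * P 1 - (e 0 - e 2) * Q 0 * P 0

/-- The polar (tangent) form of `H₃` at `Q`. [cite: Wang2016CongruentSha, §2.2 (arXiv:1511.03810 p0005 L1)] -/
def L₃ (e d : Fin 3 → F) (Q P : Fin 4 → F) : F :=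
  d 0 * Q 1 * P 1 - d 1 * Q 2 * P 2 - (e 1 - e 0) * Q 0 * P 0

/-- `L₁(Q, Q) = H₁(Q)` (the polar form restricts to the quadratic form). [cite: Wang2016CongruentSha, §2.2 (arXiv:1511.03810 p0005 L1)] -/
theorem L₁_self (e d : Fin 3 → F) (Q : Fin 4 → F) : L₁ e d Q Q = H₁ e d Q := by
  simp only [L₁, H₁]
  ring

/-- `L₂(Q, Q) = H₂(Q)`. [cite: Wang2016CongruentSha, §2.2 (arXiv:1511.03810 p0005 L1)] -/
theorem L₂_self (e d : Fin 3 → F) (Q : Fin 4 → F) : L₂ e d Q Q = H₂ e d Q := by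
  simp only [L₂, H₂]
  ring

/-- `L₃(Q, Q) = H₃(Q)`. [cite: Wang2016CongruentSha, §2.2 (arXiv:1511.03810 p0005 L1)] -/
theorem L₃_self (e d : Fin 3 → F) (Q : Fin 4 → F) : L₃ e d Q Q = H₃ e d Q := by
  simp only [L₃, H₃]
  ring

/-- Tangency: `H₁(Q + P) = H₁(Q) + 2·L₁(Q, P) + H₁(P)` (so `L₁(Q, ·) = 0` is the tangent plane at a
point `Q` of the cone `H₁ = 0`). [cite: Wang2016CongruentSha, §2.2 (arXiv:1511.03810 p0005 L1: tangent of H_i at Q_i)] -/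
theorem H₁_add (e d : Fin 3 → F) (Q P : Fin 4 → F) :
    H₁ e d (Q + P) = H₁ e d Q + 2 * L₁ e d Q P + H₁ e d P := by
  simp only [H₁, L₁, Pi.add_apply]
  ring

/-- Tangency for `H₂`. [cite: Wang2016CongruentSha, §2.2 (arXiv:1511.03810 p0005 L1)] -/
theorem H₂_add (e d : Fin 3 → F) (Q P : Fin 4 → F) :
    H₂ e d (Q + P) = H₂ e d Q + 2 * L₂ e d Q P + H₂ e d P := by
  simp only [H₂, L₂, Pi.add_apply]
  ring

/-- Tangency for `H₃`. [cite: Wang2016CongruentSha, §2.2 (arXiv:1511.03810 p0005 L1)] -/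
theorem H₃_add (e d : Fin 3 → F) (Q P : Fin 4 → F) :
    H₃ e d (Q + P) = H₃ e d Q + 2 * L₃ e d Q P + H₃ e d P := by
  simp only [H₃, L₃, Pi.add_apply]
  ring

/-- The polar forms are symmetric. [cite: Wang2016CongruentSha, §2.2 (arXiv:1511.03810 p0005 L1)] -/
theorem L₁_comm (e d : Fin 3 → F) (Q P : Fin 4 → F) : L₁ e d Q P = L₁ e d P Q := by
  simp only [L₁]
  ring

/-- Base change of coordinate vectors along `algebraMap ℚ F` (to the completions `ℚ_v`: the local
points `P_p ∈ D_Λ(ℚ_p)` and the forms `L_i` read over `ℚ_p`). [cite: Wang2016CongruentSha, §2.2 (arXiv:1511.03810 p0005 L4–L6)] -/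
def bc (F : Type*) [CommRing F] [Algebra ℚ F] {n : ℕ} (x : Fin n → ℚ) : Fin n → F :=
  fun i => algebraMap ℚ F (x i)

/-- Unfolding `bc`. [cite: Wang2016CongruentSha, §2.2 (arXiv:1511.03810 p0005 L4–L6)] -/
@[simp]
theorem bc_apply (F : Type*) [CommRing F] [Algebra ℚ F] {n : ℕ} (x : Fin n → ℚ) (i : Fin n) :
    bc F x i = algebraMap ℚ F (x i) :=
  rfl

/-- `H₁` commutes with base change. [cite: Wang2016CongruentSha, §2.2 (arXiv:1511.03810 p0005 L4–L6)] -/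
theorem H₁_bc (F : Type*) [CommRing F] [Algebra ℚ F] (e d : Fin 3 → ℚ) (P : Fin 4 → ℚ) :
    H₁ (bc F e) (bc F d) (bc F P) = algebraMap ℚ F (H₁ e d P) := by
  simp only [H₁, bc_apply, map_sub, map_mul, map_pow]

/-- `H₂` commutes with base change. [cite: Wang2016CongruentSha, §2.2 (arXiv:1511.03810 p0005 L4–L6)] -/
theorem H₂_bc (F : Type*) [CommRing F] [Algebra ℚ F] (e d : Fin 3 → ℚ) (P : Fin 4 → ℚ) :
    H₂ (bc F e) (bc F d) (bc F P) = algebraMap ℚ F (H₂ e d P) := by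
  simp only [H₂, bc_apply, map_sub, map_mul, map_pow]

/-- `H₃` commutes with base change. [cite: Wang2016CongruentSha, §2.2 (arXiv:1511.03810 p0005 L4–L6)] -/
theorem H₃_bc (F : Type*) [CommRing F] [Algebra ℚ F] (e d : Fin 3 → ℚ) (P : Fin 4 → ℚ) :
    H₃ (bc F e) (bc F d) (bc F P) = algebraMap ℚ F (H₃ e d P) := by
  simp only [H₃, bc_apply, map_sub, map_mul, map_pow]

end Quadrics

/-! ## §2 The local terms `∏_i (L_i(P_v), d'_i)_v` and Cassels data -/

section Local

variable (F : Type*) [Field F]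

/-- A local point `P ∈ D_Λ(F)` in general position with respect to the three tangent planes: on the
covering and with `L_i(Q_i, P) ≠ 0`, `i = 1, 2, 3` (so that the three Hilbert symbols are taken at
non-zero arguments). [cite: Wang2016CongruentSha, §2.2 (arXiv:1511.03810 p0005 L1–L6)] -/
def IsAdmissible (e d : Fin 3 → F) (Q₁ Q₂ Q₃ P : Fin 4 → F) : Prop :=
  P ∈ homSpace e d ∧ L₁ e d Q₁ P ≠ 0 ∧ L₂ e d Q₂ P ≠ 0 ∧ L₃ e d Q₃ P ≠ 0

/-- **Cassels' local term** at a completion `F = ℚ_v`: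
`⟨Λ, Λ'⟩_v = ∏_{i=1}^{3} (L_i(P_v), d'_i)_v ∈ {±1}`, with the tree's `hilbertSymbol F`
(O'Meara §63B). [cite: Wang2016CongruentSha, §2.2 (arXiv:1511.03810 p0005 L4–L6)]
[cite: Cassels1998, the definition of ⟨Λ, Λ'⟩ (via Wang 2016 §2.2 / Wang–Zhang 2022 §2.3)] -/
def localTerm (e d d' : Fin 3 → F) (Q₁ Q₂ Q₃ P : Fin 4 → F) : ℤ :=
  hilbertSymbol F (L₁ e d Q₁ P) (d' 0) * hilbertSymbol F (L₂ e d Q₂ P) (d' 1) *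
    hilbertSymbol F (L₃ e d Q₃ P) (d' 2)

variable {F}

/-- The local term is `±1` (a product of three Hilbert symbols). [cite: Omeara1963, §63B (definition of the Hilbert symbol)] -/
theorem localTerm_eq_one_or_eq_neg_one (e d d' : Fin 3 → F) (Q₁ Q₂ Q₃ P : Fin 4 → F) :
    localTerm F e d d' Q₁ Q₂ Q₃ P = 1 ∨ localTerm F e d d' Q₁ Q₂ Q₃ P = -1 := by
  unfold localTerm
  rcases hilbertSymbol_eq_one_or_eq_neg_one (F := F) (L₁ e d Q₁ P) (d' 0) with h1 | h1 <;>
    rcases hilbertSymbol_eq_one_or_eq_neg_one (F := F) (L₂ e d Q₂ P) (d' 1) with h2 | h2 <;>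
      rcases hilbertSymbol_eq_one_or_eq_neg_one (F := F) (L₃ e d Q₃ P) (d' 2) with h3 | h3 <;>
        simp [h1, h2, h3]

end Local

/-- **A Cassels datum** for the covering `D_Λ` of `E : y² = (x − e₁)(x − e₂)(x − e₃)` over `ℚ`
(`e = (e_i)`, `Λ = d = (d_i)`): three rational points `Q_i ∈ H_i(ℚ)` («the existence of `Q_i`
follows from Hasse–Minkowski principle, since `H_i` is locally solvable everywhere as `D_Λ` is so»)
and, at every place of `ℚ` — finite `v` (`ℚ_v = v.adicCompletion ℚ`) and infinite `w`
(`w.Completion`), the places of the tree's `selmerGroup` — a point of `D_Λ(ℚ_v)` off the three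
tangent planes `L_i(Q_i, ·) = 0` («`P = (P_p) ∈ D_Λ(𝔸)` any adelic point»; `D_Λ` is projective, so
an adelic point is a family of local points, taken here in general position so that every symbol
`(L_i(P_v), d'_i)_v` is defined). [cite: Wang2016CongruentSha, §2.2 (arXiv:1511.03810 p0005 L1–L6)]
[cite: Cassels1998, definition of the pairing (via Wang 2016 §2.2, Wang–Zhang 2022 §2.3 p. 5)] -/
structure Datum (e d : Fin 3 → ℚ) where
  /-- a rational point of the cone `H₁` -/
  Q₁ : Fin 4 → ℚ
  /-- a rational point of the cone `H₂` -/
  Q₂ : Fin 4 → ℚ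
  /-- a rational point of the cone `H₃` -/
  Q₃ : Fin 4 → ℚ
  H₁_Q₁ : H₁ e d Q₁ = 0
  H₂_Q₂ : H₂ e d Q₂ = 0
  H₃_Q₃ : H₃ e d Q₃ = 0
  /-- the local point at the finite place `v` -/
  ptFin : (v : HeightOneSpectrum (𝓞 ℚ)) → Fin 4 → v.adicCompletion ℚ
  /-- the local point at the infinite place `w` -/
  ptInf : (w : InfinitePlace ℚ) → Fin 4 → w.Completion
  admissible_fin : ∀ v : HeightOneSpectrum (𝓞 ℚ),
    IsAdmissible (v.adicCompletion ℚ) (bc _ e) (bc _ d) (bc _ Q₁) (bc _ Q₂) (bc _ Q₃) (ptFin v)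
  admissible_inf : ∀ w : InfinitePlace ℚ,
    IsAdmissible w.Completion (bc _ e) (bc _ d) (bc _ Q₁) (bc _ Q₂) (bc _ Q₃) (ptInf w)

namespace Datum

variable {e d : Fin 3 → ℚ} (𝒟 : Datum e d) (d' : Fin 3 → ℚ)

/-- The local term `⟨Λ, Λ'⟩_v` of the datum at a finite place `v`, for `Λ' = d'`.
[cite: Wang2016CongruentSha, §2.2 (arXiv:1511.03810 p0005 L4–L6)] -/
def finTerm (v : HeightOneSpectrum (𝓞 ℚ)) : ℤ :=
  localTerm (v.adicCompletion ℚ) (bc _ e) (bc _ d) (bc _ d') (bc _ 𝒟.Q₁) (bc _ 𝒟.Q₂) (bc _ 𝒟.Q₃)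
    (𝒟.ptFin v)

/-- The local term `⟨Λ, Λ'⟩_w` of the datum at an infinite place `w`, for `Λ' = d'`.
[cite: Wang2016CongruentSha, §2.2 (arXiv:1511.03810 p0005 L4–L6)] -/
def infTerm (w : InfinitePlace ℚ) : ℤ :=
  localTerm w.Completion (bc _ e) (bc _ d) (bc _ d') (bc _ 𝒟.Q₁) (bc _ 𝒟.Q₂) (bc _ 𝒟.Q₃) (𝒟.ptInf w)

/-- The finite places where the local term is `−1` («almost all local Cassels pairing are `1`»,
Lemma 7.2). [cite: Cassels1998, Lemma 7.2 (via Wang 2016 Lemma 2, arXiv:1511.03810 p0005 L16–L24)] -/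
def oddFin : Set (HeightOneSpectrum (𝓞 ℚ)) :=
  {v | 𝒟.finTerm d' v = -1}

/-- The infinite places where the local term is `−1`. [cite: Wang2016CongruentSha, §2.2 (arXiv:1511.03810 p0005 L4–L6)] -/
def oddInf : Set (InfinitePlace ℚ) :=
  {w | 𝒟.infTerm d' w = -1}

/-- Unfolding `oddFin`. [cite: Wang2016CongruentSha, §2.2 (arXiv:1511.03810 p0005 L4–L16)] -/
theorem mem_oddFin_iff (v : HeightOneSpectrum (𝓞 ℚ)) : v ∈ 𝒟.oddFin d' ↔ 𝒟.finTerm d' v = -1 :=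
  Iff.rfl

/-- Unfolding `oddInf`. [cite: Wang2016CongruentSha, §2.2 (arXiv:1511.03810 p0005 L4–L6)] -/
theorem mem_oddInf_iff (w : InfinitePlace ℚ) : w ∈ 𝒟.oddInf d' ↔ 𝒟.infTerm d' w = -1 :=
  Iff.rfl

/-- The set of infinite places with odd local term is finite (`ℚ` has finitely many infinite
places). [cite: Wang2016CongruentSha, §2.2 (arXiv:1511.03810 p0005 L4–L6: the place ∞)] -/
theorem oddInf_finite : (𝒟.oddInf d').Finite :=
  Set.toFinite _

end Datum

/-! ## §3 The component triple of a Selmer class and the named fact -/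

section Fact

/-- **The component triple `Λ = (d₁, d₂, d₃)` of a class `c ∈ H¹(ℚ, E[2])`**: `d₁`, `d₂` represent
the images of `c` under `H¹(χ₁)`, `H¹(χ₂)` read through Kummer theory `H¹(ℚ, μ₂) ≃ ℚˣ/ℚˣ²` (the
tree's `kummerEquiv ℚ 2 ∘ W.twoTorsionCharH1 h`, resp. `h.swap₁₂`; on `κ(P)` these are `x(P) − e₁`,
`x(P) − e₂`: `kummerEquiv_twoTorsionCharH1_kummerMapTorsion`), and `d₁d₂d₃` is a square
(`d₃ ↔ x − e₃ ≡ (x − e₁)(x − e₂) · y² /((x−e₁)(x−e₂))²`). «`Sel₂(E) = {Λ = (d₁,d₂,d₃) ∈ (ℚˣ/ℚˣ²)³ |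
D_Λ(𝔸) ≠ ∅, d₁d₂d₃ ∈ ℚˣ²}`». [cite: Wang2016CongruentSha, §2 (arXiv:1511.03810 p0004 L5–L20)]
[cite: SilvermanAEC2009, Prop. X.1.4] -/
def HasComponents (W : WeierstrassCurve ℚ) [W.IsElliptic] {e₁ e₂ e₃ : ℚ}
    (h : W.toAffine.SplitTwoTorsion e₁ e₂ e₃) (c : galH1Torsion W 2) (d : Fin 3 → ℚˣ) : Prop :=
  kummerEquiv ℚ 2 (W.twoTorsionCharH1 h c) = Additive.ofMul (QuotientGroup.mk (d 0)) ∧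
    kummerEquiv ℚ 2 (W.twoTorsionCharH1 h.swap₁₂ c) = Additive.ofMul (QuotientGroup.mk (d 1)) ∧
      IsSquare ((d 0 : ℚ) * d 1 * d 2)

/-- Every class has a component triple (representatives of the two Kummer classes, and `d₃ := d₁d₂`):
the binder `HasComponents` of the fact is never vacuous. [cite: SilvermanAEC2009, Prop. X.1.4] -/
theorem exists_hasComponents (W : WeierstrassCurve ℚ) [W.IsElliptic] {e₁ e₂ e₃ : ℚ}
    (h : W.toAffine.SplitTwoTorsion e₁ e₂ e₃) (c : galH1Torsion W 2) :
    ∃ d : Fin 3 → ℚˣ, HasComponents W h c d := by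
  obtain ⟨a, ha⟩ := QuotientGroup.mk_surjective (Additive.toMul (kummerEquiv ℚ 2 (W.twoTorsionCharH1 h c)))
  obtain ⟨b, hb⟩ :=
    QuotientGroup.mk_surjective (Additive.toMul (kummerEquiv ℚ 2 (W.twoTorsionCharH1 h.swap₁₂ c)))
  refine ⟨![a, b, a * b], ?_, ?_, ?_⟩
  · rw [Matrix.cons_val_zero, ha, ofMul_toMul]
  · rw [Matrix.cons_val_one, Matrix.cons_val_zero, hb, ofMul_toMul]
  · refine ⟨(a : ℚ) * b, ?_⟩
    simp only [Matrix.cons_val_zero, Matrix.cons_val_one, Matrix.cons_val_two, Matrix.tail_cons,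
      Matrix.head_cons, Units.val_mul]

/-- Cassels' model `y² = (x − e₁)(x − e₂)(x − e₃)` has rational `2`-torsion `e₁, e₂, e₃` in the tree's
sense (`b₂ = −4Σe_i`, `b₄ = 2Σe_ie_j`, `b₆ = −4e₁e₂e₃`): the binder `h` of the fact is inhabited.
[cite: SilvermanAEC2009, Prop. X.1.4 (the model with E[2] ⊆ E(K))] -/
theorem splitTwoTorsion_of_eq {W : WeierstrassCurve ℚ} {e₁ e₂ e₃ : ℚ}
    (hW : W = ⟨0, -(e₁ + e₂ + e₃), 0, e₁ * e₂ + e₁ * e₃ + e₂ * e₃, -(e₁ * e₂ * e₃)⟩) :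
    W.toAffine.SplitTwoTorsion e₁ e₂ e₃ := by
  subst hW
  exact ⟨by show (0 : ℚ) ^ 2 + 4 * (-(e₁ + e₂ + e₃)) = _; ring,
    by show 2 * (e₁ * e₂ + e₁ * e₃ + e₂ * e₃) + 0 * 0 = _; ring,
    by show (0 : ℚ) ^ 2 + 4 * (-(e₁ * e₂ * e₃)) = _; ring⟩

/-- **Cassels 1998 — the Cassels–Tate pairing on `Sel⁽²⁾(E/ℚ)` as a sum of local Hilbert symbols.**
For `E : y² = (x − e₁)(x − e₂)(x − e₃)` over `ℚ` (`e_i ∈ ℚ`; distinct, as `E` is elliptic) there is a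
bi-additive alternating pairing `B` on `Ш(E/ℚ)` with `⟨a, Ш[m]⟩ = 0 ⟺ a ∈ mШ` for every `m ≠ 0` —
the Cassels–Tate pairing, in the currency of `casselsTate_pairing_levelKernel` (Milne *ADT* I
6.13(a)/6.17) — whose pull-back `ctSelmer B 2 2` to `Sel⁽²⁾(E/ℚ) × Sel⁽²⁾(E/ℚ)` («a skew-symmetric
bilinear pairing on `Sel₂(E)/E(ℚ)[2]` … with kernel `Im Sel₄(E)/E(ℚ)[2]`») is COMPUTED BY CASSELS'
RECIPE: for `s, t ∈ Sel⁽²⁾(E/ℚ)` with component triples `Λ = (d₁,d₂,d₃)`, `Λ' = (d'₁,d'₂,d'₃)`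
(`d_i ↔ x − e_i`, `d₁d₂d₃ ∈ ℚˣ²`), (a) a Cassels datum exists — rational points `Q_i` on the cones
`H_i ⊃ D_Λ` («by Hasse–Minkowski principle, since `H_i` is locally solvable everywhere as `D_Λ` is
so») and a point of `D_Λ(ℚ_v)` off the tangent planes `L_i(Q_i, ·) = 0` at every place; and (b) for
EVERY such datum, the local terms `⟨Λ, Λ'⟩_v = ∏_i (L_i(P_v), d'_i)_v` are `−1` at only finitely
many places («almost all local Cassels pairing are `1`», Lemma 7.2) and
`⟨Λ, Λ'⟩ = ∏_v ∏_{i=1}^{3} (L_i(P_v), d'_i)_v` IS the Cassels–Tate pairing of `s, t`: the value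
`ctSelmer B 2 2 s t ∈ {0, ½} ⊂ ℚ/ℤ` is `0` iff the number of places `v` (finite and infinite) with
`⟨Λ, Λ'⟩_v = −1` is even («This pairing is independent of the choice of `P` and `Q_i`, and is
trivial on `E(ℚ)[2]`» — theorems below). Primary text not held (acq-14297); transcribed from the two
held restatements quoted in the module docstring, which agree verbatim, and from Fisher 2022 §1 for
«Cassels [Ca98] described a method for computing the [Cassels–Tate] pairing in the case `n = 2`».
No `_holds` today (no construction of the pairing over `ℚ` at level `2` in the tree); consumers take
`(hC : pairing_selmerTwo_eq_hilbertSymbolProduct)`.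
-- TODO(general form): any number field `K`; `E` with a single rational `2`-torsion point
-- (Cassels §§8 ff., Fisher 2022); Lemma 7.2 as an evaluation theorem of `localTerm`.
[cite: Cassels1998, the pairing ⟨Λ,Λ'⟩ = ∏_p ∏_i (L_i(P_p), d'_i)_p on S⁽²⁾, its independence of choices, kernel = image of S⁽⁴⁾, Lemma 7.2 — via Wang 2016 §1 p. 3, §2.2 pp. 4–5 (arXiv:1511.03810 p0003 L36, p0004 L88 – p0005 L24) and Wang–Zhang 2022 §2.3 p. 5]
[cite: Wang2016CongruentSha, §2 (p0004 L5–L20: Sel₂ = {Λ : D_Λ(𝔸) ≠ ∅}), §2.2 (p0004 L88 – p0005 L24)]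
[cite: MilneADT2006, Ch. I §6 Thm. 6.13(a), Lemma 6.17] [cite: SilvermanAEC2009, Prop. X.1.4, Thm. X.4.14] -/
def pairing_selmerTwo_eq_hilbertSymbolProduct : Prop :=
  ∀ (e₁ e₂ e₃ : ℚ) (W : WeierstrassCurve ℚ) [W.IsElliptic],
    W = ⟨0, -(e₁ + e₂ + e₃), 0, e₁ * e₂ + e₁ * e₃ + e₂ * e₃, -(e₁ * e₂ * e₃)⟩ →
      ∀ h : W.toAffine.SplitTwoTorsion e₁ e₂ e₃,
        ∃ B : W.sha →+ W.sha →+ AddCircle (1 : ℚ),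
          (∀ a, B a a = 0) ∧
            (∀ m : ℤ, m ≠ 0 → ∀ a : W.sha,
              (∀ a' : W.sha, m • a' = 0 → B a a' = 0) ↔ ∃ b : W.sha, m • b = a) ∧
            ∀ (s t : selmerGroup W 2) (d d' : Fin 3 → ℚˣ),
              HasComponents W h (s : galH1Torsion W 2) d →
                HasComponents W h (t : galH1Torsion W 2) d' →
                  Nonempty (Datum ![e₁, e₂, e₃] (fun i => (d i : ℚ))) ∧
                    ∀ 𝒟 : Datum ![e₁, e₂, e₃] (fun i => (d i : ℚ)),
                      (𝒟.oddFin (fun i => (d' i : ℚ))).Finite ∧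
                        (ctSelmer B 2 2 s t = 0 ↔
                          Even ((𝒟.oddFin (fun i => (d' i : ℚ))).ncard +
                            (𝒟.oddInf (fun i => (d' i : ℚ))).ncard))

end Fact

/-! ## §4 Consequences (theorems): independence of the datum, symmetry, triviality on `κ(E(ℚ))`,
kernel = `[2]_* Sel⁽⁴⁾(E/ℚ)`, and the tree's (U4) shape -/

section Consequences

variable {e₁ e₂ e₃ : ℚ} {W : WeierstrassCurve ℚ} [W.IsElliptic]

/-- Cassels' parity for a pair of data/component triples: the predicate «the number of places with
local term `−1` is even» (the global symbol `⟨Λ, Λ'⟩ = +1`). Definition with body (a `Prop`-valued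
reading of a datum; nothing is asserted). [cite: Wang2016CongruentSha, §2.2 (arXiv:1511.03810 p0005 L4–L6)] -/
def Datum.IsEven {e d : Fin 3 → ℚ} (𝒟 : Datum e d) (d' : Fin 3 → ℚ) : Prop :=
  Even ((𝒟.oddFin d').ncard + (𝒟.oddInf d').ncard)

/-- Unfolding `Datum.IsEven`. [cite: Wang2016CongruentSha, §2.2 (arXiv:1511.03810 p0005 L4–L6)] -/
theorem Datum.isEven_iff {e d : Fin 3 → ℚ} (𝒟 : Datum e d) (d' : Fin 3 → ℚ) :
    𝒟.IsEven d' ↔ Even ((𝒟.oddFin d').ncard + (𝒟.oddInf d').ncard) :=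
  Iff.rfl

/-- **Independence of the datum** («This pairing is independent of the choice of `P` and `Q_i`»):
two Cassels data for the same `Λ` give the same global symbol against every `Λ'` coming from a Selmer
class. [cite: Cassels1998, independence of choices (via Wang–Zhang 2022 §2.3 p. 5)] -/
theorem isEven_iff_isEven_of_fact (hC : pairing_selmerTwo_eq_hilbertSymbolProduct)
    (hW : W = ⟨0, -(e₁ + e₂ + e₃), 0, e₁ * e₂ + e₁ * e₃ + e₂ * e₃, -(e₁ * e₂ * e₃)⟩)
    (h : W.toAffine.SplitTwoTorsion e₁ e₂ e₃) (s t : selmerGroup W 2) (d d' : Fin 3 → ℚˣ)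
    (hs : HasComponents W h (s : galH1Torsion W 2) d) (ht : HasComponents W h (t : galH1Torsion W 2) d')
    (𝒟₁ 𝒟₂ : Datum ![e₁, e₂, e₃] (fun i => (d i : ℚ))) :
    𝒟₁.IsEven (fun i => (d' i : ℚ)) ↔ 𝒟₂.IsEven (fun i => (d' i : ℚ)) := by
  obtain ⟨B, -, -, hB⟩ := hC e₁ e₂ e₃ W hW h
  obtain ⟨-, h₁⟩ := hB s t d d' hs ht
  rw [Datum.isEven_iff, Datum.isEven_iff, ← (h₁ 𝒟₁).2, ← (h₁ 𝒟₂).2]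

/-- **Symmetry** (skew-symmetry over `𝔽₂` is symmetry): the global symbol of `(Λ, Λ')` equals that of
`(Λ', Λ)`, for data on either side. [cite: Wang2016CongruentSha, §2.2 (arXiv:1511.03810 p0005 L8: "skew-symmetry over 𝔽₂ is also symmetry")] -/
theorem isEven_symm_of_fact (hC : pairing_selmerTwo_eq_hilbertSymbolProduct)
    (hW : W = ⟨0, -(e₁ + e₂ + e₃), 0, e₁ * e₂ + e₁ * e₃ + e₂ * e₃, -(e₁ * e₂ * e₃)⟩)
    (h : W.toAffine.SplitTwoTorsion e₁ e₂ e₃) (s t : selmerGroup W 2) (d d' : Fin 3 → ℚˣ)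
    (hs : HasComponents W h (s : galH1Torsion W 2) d) (ht : HasComponents W h (t : galH1Torsion W 2) d')
    (𝒟 : Datum ![e₁, e₂, e₃] (fun i => (d i : ℚ))) (𝒟' : Datum ![e₁, e₂, e₃] (fun i => (d' i : ℚ))) :
    𝒟.IsEven (fun i => (d' i : ℚ)) ↔ 𝒟'.IsEven (fun i => (d i : ℚ)) := by
  obtain ⟨B, halt, -, hB⟩ := hC e₁ e₂ e₃ W hW h
  obtain ⟨-, h₁⟩ := hB s t d d' hs ht
  obtain ⟨-, h₂⟩ := hB t s d' d ht hs
  rw [Datum.isEven_iff, Datum.isEven_iff, ← (h₁ 𝒟).2, ← (h₂ 𝒟').2,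
    ctSelmer_swap B halt 2 2 s t, neg_eq_zero]

/-- **Kernel = `[2]_* Sel⁽⁴⁾(E/ℚ)`** («the kernel of the Cassels pairing is `Im Sel₄(E)/E(ℚ)[2]`»):
a class `s ∈ Sel⁽²⁾(E/ℚ)` lifts to `Sel⁽⁴⁾(E/ℚ)` iff Cassels' global symbol `⟨Λ, Λ'⟩` is `+1` for
every `Λ'` coming from a Selmer class (computed with any data). From the fact and the tree's
`selmerTwo_kernel_iff_mem_range` (Milne I 6.17 at `m = 2` in Selmer form).
[cite: Cassels1998, kernel of the pairing = image of S⁽⁴⁾ (via Wang 2016 §1 p0003 L36, §2.2 p0005 L8–L14)]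
[cite: MilneADT2006, Ch. I §6 Lemma 6.17] -/
theorem mem_range_selmerZSMul_iff_of_fact (hC : pairing_selmerTwo_eq_hilbertSymbolProduct)
    (hW : W = ⟨0, -(e₁ + e₂ + e₃), 0, e₁ * e₂ + e₁ * e₃ + e₂ * e₃, -(e₁ * e₂ * e₃)⟩)
    (h : W.toAffine.SplitTwoTorsion e₁ e₂ e₃) (s : selmerGroup W 2) (d : Fin 3 → ℚˣ)
    (hs : HasComponents W h (s : galH1Torsion W 2) d) :
    s ∈ (selmerZSMul W (d := 2) (n := 4) 2 (by norm_num)).range ↔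
      ∀ (t : selmerGroup W 2) (d' : Fin 3 → ℚˣ), HasComponents W h (t : galH1Torsion W 2) d' →
        ∀ 𝒟 : Datum ![e₁, e₂, e₃] (fun i => (d i : ℚ)), 𝒟.IsEven (fun i => (d' i : ℚ)) := by
  obtain ⟨B, -, hlev, hB⟩ := hC e₁ e₂ e₃ W hW h
  rw [← selmerTwo_kernel_iff_mem_range B hlev s]
  constructor
  · intro hker t d' ht 𝒟
    rw [Datum.isEven_iff, ← ((hB s t d d' hs ht).2 𝒟).2]
    exact hker t
  · intro hev t
    obtain ⟨d', ht⟩ := exists_hasComponents W h (t : galH1Torsion W 2)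
    obtain ⟨⟨𝒟⟩, h𝒟⟩ := hB s t d d' hs ht
    exact ((h𝒟 𝒟).2).mpr (hev t d' ht 𝒟)

/-- **Triviality on `κ(E(ℚ))`** («trivial on `E(ℚ)[2]`», and more generally on the image of the
Kummer map, which lies in `[2]_* Sel⁽⁴⁾`): a class in the image of `[2]_* : Sel⁽⁴⁾ → Sel⁽²⁾` has
global symbol `+1` against everything. [cite: Wang2016CongruentSha, §2.2 (arXiv:1511.03810 p0005 L8–L14)] -/
theorem isEven_of_mem_range_of_fact (hC : pairing_selmerTwo_eq_hilbertSymbolProduct)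
    (hW : W = ⟨0, -(e₁ + e₂ + e₃), 0, e₁ * e₂ + e₁ * e₃ + e₂ * e₃, -(e₁ * e₂ * e₃)⟩)
    (h : W.toAffine.SplitTwoTorsion e₁ e₂ e₃) (s t : selmerGroup W 2) (d d' : Fin 3 → ℚˣ)
    (hs : HasComponents W h (s : galH1Torsion W 2) d) (ht : HasComponents W h (t : galH1Torsion W 2) d')
    (hrange : s ∈ (selmerZSMul W (d := 2) (n := 4) 2 (by norm_num)).range)
    (𝒟 : Datum ![e₁, e₂, e₃] (fun i => (d i : ℚ))) : 𝒟.IsEven (fun i => (d' i : ℚ)) :=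
  (mem_range_selmerZSMul_iff_of_fact hC hW h s d hs).mp hrange t d' ht 𝒟

/-- **The (U4) shape follows** for Cassels' curves: the pairing `C = ctSelmer B 2 2` of the fact is
alternating with left and right kernels `[2]_* Sel⁽⁴⁾(E/ℚ)` — the output of
`exists_ctSelmer_two` — AND is computed by Cassels' recipe. [cite: MilneADT2006, Ch. I §6 Thm. 6.13(a), Lemma 6.17]
[cite: Cassels1998, kernel of the pairing (via Wang 2016 §1 p0003 L36)] -/
theorem exists_ctSelmer_two_computed_of_fact (hC : pairing_selmerTwo_eq_hilbertSymbolProduct)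
    (hW : W = ⟨0, -(e₁ + e₂ + e₃), 0, e₁ * e₂ + e₁ * e₃ + e₂ * e₃, -(e₁ * e₂ * e₃)⟩)
    (h : W.toAffine.SplitTwoTorsion e₁ e₂ e₃) :
    ∃ C : selmerGroup W 2 →+ selmerGroup W 2 →+ AddCircle (1 : ℚ),
      (∀ s, C s s = 0) ∧
        (∀ s, (∀ t, C s t = 0) ↔ s ∈ (selmerZSMul W (d := 2) (n := 4) 2 (by norm_num)).range) ∧
          (∀ t, (∀ s, C s t = 0) ↔ t ∈ (selmerZSMul W (d := 2) (n := 4) 2 (by norm_num)).range) ∧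
            ∀ (s t : selmerGroup W 2) (d d' : Fin 3 → ℚˣ),
              HasComponents W h (s : galH1Torsion W 2) d →
                HasComponents W h (t : galH1Torsion W 2) d' →
                  ∀ 𝒟 : Datum ![e₁, e₂, e₃] (fun i => (d i : ℚ)),
                    C s t = 0 ↔ 𝒟.IsEven (fun i => (d' i : ℚ)) := by
  obtain ⟨B, halt, hlev, hB⟩ := hC e₁ e₂ e₃ W hW h
  refine ⟨ctSelmer B 2 2, ctSelmer_self_eq_zero B halt 2, selmerTwo_kernel_iff_mem_range B hlev,
    fun t => ?_, fun s t d d' hs ht 𝒟 => ?_⟩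
  · rw [ctSelmer_right_kernel_iff B halt hlev two_ne_zero two_ne_zero t, AddMonoidHom.mem_range]
    exact Iff.rfl
  · rw [Datum.isEven_iff]
    exact ((hB s t d d' hs ht).2 𝒟).2

end Consequences

end Cassels1998

end Literature.NumberTheory.EllipticCurves

end
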